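import Summits.BirchSwinnertonDyer.Rank1Residual.AdditivePotMult.QuadraticBaseChangeSplitParity
import Summits.BirchSwinnertonDyer.Rank1Residual.Additive.SplitMultiplicativeWitnessOfTamagawa
import Literature.NumberTheory.EllipticCurves.NonsplitProofs
import HarnessLib

/-!
# The local Tamagawa numbers of `V ⊗ K` above a multiplicative place of `V/ℚ`
# (row T-MIL-ODD, FILE A-1b; seat n1011-p01 GEN 5)

HONEST FRAMING (cell `b2b-bsdres`, run/shared/lean/b2b/bsd-rank1-residual/, verbatim in every
file): the goal of the cell is to DELETE the COMBINATION-SHAPED residual classes of the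
Birch–Swinnerton-Dyer formula for ALL analytic-rank `≤ 1` elliptic curves over `ℚ` — "full BSD
formula for every rank `≤ 1` curve in class `C`" assembled STRICTLY from published theorems — so
that the rank-`≤ 1` remainder becomes exactly the CONSTRUCTION-SHAPED classes, which are TYPED
(missing-input `Prop`s), NOT attempted. This is not "finishing BSD". Sub-classes X3♯(M) / X4(M)
(additive, potentially multiplicative prime; base-change-and-descend): a RESEARCH ROUTE; they stay
CONSTRUCTION-SHAPED; nothing is booked by this file; no mark / label moved. THEOREMS ONLY: no
definition, no named fact, no `sorry`.

## What and why (row T-MIL-ODD, `cells/n1011/skel/T-MIL-ODD.md`)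

The odd part of Milne's quadratic BSD-quotient identity (`hWR` of `AdditivePotMult/Descent.lean`,
named facts A65/A73; `hodd` of the tree's `bsdRHS_baseChange_quadratic_of_padicValRat`) is a sum
of local identities (L_ℓ)@p, one per rational prime `ℓ`. This file gives the entries at a
MULTIPLICATIVE place `v` of `V/ℚ` (globally minimal), for `K` ANY number field and `𝔭 ∣ v`:

* `ordMinimalDiscriminant_baseChange_eq_mul_of_hasMultiplicativeReductionAt` —
  `ord_𝔭 Δ_min(V ⊗ K) = e(𝔭|v) · ord_v Δ_min(V)` (multiplicative, split or not; the split case is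
  this seat's gen-3 lemma);
* (the pure persistence form **`c_𝔭(V ⊗ K) = e(𝔭|v) · c_v(V)`** at a split place of `V` is
  n1011-p16's banked `Additive/SplitMultiplicativeTamagawaPersistence.lean`
  (`localTamagawaNumber_baseChange_eq_ramificationIdx_mul_of_hasSplitMultiplicativeReductionAt`),
  filed by p16 on this row's 'wanted' — one producer per theorem; not restated here);
* `localTamagawaNumber_baseChange_eq_mul_ordMinimalDiscriminant_of_split` /
  `localTamagawaNumber_baseChange_eq_one_or_two_of_not_split` — `c_𝔭 = e·n` if `V ⊗ K` is split at
  `𝔭`, `c_𝔭 ∈ {1, 2}` if not; and the odd-`p` valuations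
  `padicValNat_localTamagawaNumber_baseChange_of_split` / `…_eq_zero_of_not_split`;
* the PARITY forms (sibling `QuadraticBaseChangeSplitParity.lean`): `N(𝔭) = ℓ^f` with `f` even ⇒
  `c_𝔭 = e·n` whatever `V` is at `ℓ` (`localTamagawaNumber_baseChange_eq_mul_of_mult_of_even`);
  `f` odd and `V` non-split ⇒ `c_𝔭 ∈ {1, 2}`
  (`localTamagawaNumber_baseChange_eq_one_or_two_of_not_split_of_odd`).

So at an odd prime `p`, for a quadratic `K`: above a SPLIT prime `ℓ` (two places, `e = f = 1`)
`Σ_𝔭 v_p(c_𝔭) = 2·[split_ℓ]·v_p(n)`; above an INERT prime (one place, `f = 2`) `= v_p(n)`; above a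
RAMIFIED prime (one place, `e = 2`, `f = 1`) `= [split_ℓ]·v_p(2n) = [split_ℓ]·v_p(n)` — the
base-change side of (L_ℓ)@p at a multiplicative `ℓ` (skeleton §1 (M)). In print: Kramer, Trans.
AMS 264 (1981) §2 Props. 1–2; Silverman *ATAEC* IV.9.4 Step 2, Cor. IV.9.2 (d); *AEC* VII.1.3 (b),
VII.5.1 (b), Ex. 3.5. HONEST LIMITS: TOOL theorems; closes no class; discharges no fact by itself
(the twist side, the good / additive places, the `δ`-identity and the assembly are later files of
the row); nothing about any curve is asserted.
-/

noncomputable section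

open scoped Classical NumberField

open Polynomial WeierstrassCurve NumberField IsDedekindDomain Rat.HeightOneSpectrum
  Literature.NumberTheory.EllipticCurves Literature.NumberTheory.EllipticCurves.Rank1Residual
  Literature.NumberTheory.GaloisRepresentations Field
  Summit.BirchSwinnertonDyer.Rank1Residual.Additive

namespace Summit.BirchSwinnertonDyer.Rank1Residual.AdditivePotMult

/-! ## §3 The local Tamagawa numbers of `V ⊗ K` above a multiplicative place of `V/ℚ` -/

section Tamagawa

variable (V : WeierstrassCurve ℚ) [V.IsElliptic] [V.IsGloballyMinimal]
  {v : HeightOneSpectrum (𝓞 ℚ)} {K : Type} [Field K] [NumberField K]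
  (𝔭 : HeightOneSpectrum (𝓞 K))

/-- **`ord_𝔭 Δ_min(V ⊗ K) = e(𝔭|v) · ord_v Δ_min(V)`** for `V/ℚ` globally minimal with
MULTIPLICATIVE reduction (split or not) at the place `v`, `K` a number field, `𝔭 ∣ v`: the
`ℤ`-minimal equation stays minimal at `𝔭` (`c₄` is a unit; additive-p2's
`isMinimalAt_and_hasMultiplicativeReductionAt_baseChange_of_mult`), both minimal discriminants are
read on it, and `|x|_𝔭 = |x|_v^{e(𝔭|v)}` on `ℚ` (Mathlib `valuation_liesOver`). The split case is
this seat's gen-3 `ordMinimalDiscriminant_baseChange_eq_mul_of_hasSplitMultiplicativeReductionAt`.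
[cite: SilvermanAEC2009, VII.1 Prop. 1.3(b) and Remark 1.1, VII.5 Prop. 5.1(b)] -/
theorem ordMinimalDiscriminant_baseChange_eq_mul_of_hasMultiplicativeReductionAt
    (hmult : V.HasMultiplicativeReductionAt v) (h𝔭 : 𝔭.asIdeal.under (𝓞 ℚ) = v.asIdeal) :
    (V.baseChange K).ordMinimalDiscriminant 𝔭 =
      v.asIdeal.ramificationIdx' 𝔭.asIdeal * V.ordMinimalDiscriminant v := by
  haveI : Fact (primesEquiv v : ℕ).Prime := ⟨(primesEquiv v).2⟩
  haveI : (V.baseChange K).IsElliptic := by rw [baseChange]; infer_instance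
  haveI : 𝔭.asIdeal.LiesOver v.asIdeal := ⟨h𝔭.symm⟩
  have hmultP : V.HasMultiplicativeReductionAtPrime (primesEquiv v : ℕ) :=
    (hasMultiplicativeReductionAtPrime_iff_hasMultiplicativeReductionAt_ringOfIntegers V v).mpr hmult
  have hℓ𝔭 := natCast_primesEquiv_mem_of_under_eq 𝔭 h𝔭
  have hminQ : V.IsMinimalAt v := IsGloballyMinimal.isMinimalAt V v
  have hminK : (V.baseChange K).IsMinimalAt 𝔭 :=
    (isMinimalAt_and_hasMultiplicativeReductionAt_baseChange_of_mult V hmultP 𝔭 hℓ𝔭).1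
  have hΔQ := valuation_Δ_eq_of_isMinimalAt_holds v V hminQ
  have hΔK := valuation_Δ_eq_of_isMinimalAt_holds 𝔭 (V.baseChange K) hminK
  have hΔ : (V.baseChange K).Δ = algebraMap ℚ K V.Δ := by rw [baseChange, map_Δ]
  have hlies := IsDedekindDomain.HeightOneSpectrum.valuation_liesOver K v 𝔭 V.Δ
  rw [hΔQ, ← hΔ, hΔK, ← WithZero.exp_nsmul, WithZero.exp_inj, Int.nsmul_eq_mul] at hlies
  have h : ((V.baseChange K).ordMinimalDiscriminant 𝔭 : ℤ) =
      (v.asIdeal.ramificationIdx' 𝔭.asIdeal : ℤ) * (V.ordMinimalDiscriminant v : ℤ) := by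
    linarith
  exact_mod_cast h

/-- **`c_𝔭(V ⊗ K) = e(𝔭|v) · ord_v Δ_min(V)` when `V ⊗ K` is SPLIT multiplicative at `𝔭`**
(`V/ℚ` globally minimal, multiplicative at `v`, `𝔭 ∣ v`): `c = ord Δ_min` at a split
multiplicative place (tree, Tate's algorithm Step 2:
`localTamagawaNumber_eq_ordMinimalDiscriminant_of_hasSplitMultiplicativeReductionAt`) and the
previous lemma. [cite: SilvermanATAEC1994, IV.9.4 Step 2 and Cor. IV.9.2(d)]
[cite: SilvermanAEC2009, VII.1 Prop. 1.3(b)] -/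
theorem localTamagawaNumber_baseChange_eq_mul_ordMinimalDiscriminant_of_split
    (hmult : V.HasMultiplicativeReductionAt v) (h𝔭 : 𝔭.asIdeal.under (𝓞 ℚ) = v.asIdeal)
    (hsplit : (V.baseChange K).HasSplitMultiplicativeReductionAt 𝔭) :
    ((V.baseChange K).baseChange (𝔭.adicCompletion K)).localTamagawaNumber
        (𝔭.adicCompletionIntegers K) =
      v.asIdeal.ramificationIdx' 𝔭.asIdeal * V.ordMinimalDiscriminant v := by
  haveI : (V.baseChange K).IsElliptic := by rw [baseChange]; infer_instance
  rw [localTamagawaNumber_eq_ordMinimalDiscriminant_of_hasSplitMultiplicativeReductionAt 𝔭 _ hsplit,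
    ordMinimalDiscriminant_baseChange_eq_mul_of_hasMultiplicativeReductionAt V 𝔭 hmult h𝔭]

/-- **`c_𝔭(V ⊗ K) ∈ {1, 2}` when `V ⊗ K` is NOT split at `𝔭`** (`V/ℚ` globally minimal,
multiplicative at `v`, `𝔭 ∣ v`; `V ⊗ K` is multiplicative at `𝔭`, hence non-split multiplicative,
and Tate's algorithm Step 2 gives `c = 2` or `1` by the parity of `ord_𝔭 Δ_min`; finite residue
field). [cite: SilvermanATAEC1994, IV.9.4 Step 2 (PDF p. 344)] -/
theorem localTamagawaNumber_baseChange_eq_one_or_two_of_not_split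
    [Finite (IsLocalRing.ResidueField (𝔭.adicCompletionIntegers K))]
    (hmult : V.HasMultiplicativeReductionAt v) (h𝔭 : 𝔭.asIdeal.under (𝓞 ℚ) = v.asIdeal)
    (hns : ¬ (V.baseChange K).HasSplitMultiplicativeReductionAt 𝔭) :
    ((V.baseChange K).baseChange (𝔭.adicCompletion K)).localTamagawaNumber
        (𝔭.adicCompletionIntegers K) = 1 ∨
      ((V.baseChange K).baseChange (𝔭.adicCompletion K)).localTamagawaNumber
        (𝔭.adicCompletionIntegers K) = 2 := by
  haveI : Fact (primesEquiv v : ℕ).Prime := ⟨(primesEquiv v).2⟩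
  haveI : (V.baseChange K).IsElliptic := by rw [baseChange]; infer_instance
  have hmultP : V.HasMultiplicativeReductionAtPrime (primesEquiv v : ℕ) :=
    (hasMultiplicativeReductionAtPrime_iff_hasMultiplicativeReductionAt_ringOfIntegers V v).mpr hmult
  have hmultK : (V.baseChange K).HasMultiplicativeReductionAt 𝔭 :=
    (isMinimalAt_and_hasMultiplicativeReductionAt_baseChange_of_mult V hmultP 𝔭
      (natCast_primesEquiv_mem_of_under_eq 𝔭 h𝔭)).2
  have h := localTamagawaNumber_of_hasNonsplitMultiplicativeReductionAt_holds (v := 𝔭)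
    (W := V.baseChange K) hmultK hns
  rw [h]
  split_ifs
  · exact Or.inr rfl
  · exact Or.inl rfl

/-- **Odd `p`: `v_p(c_𝔭(V ⊗ K)) = 0` at a NON-split place above a multiplicative place of `V`**
(`c_𝔭 ∈ {1, 2}`). The non-split entry of the local identity (L_ℓ)@p of row T-MIL-ODD.
[cite: SilvermanATAEC1994, IV.9.4 Step 2 (PDF p. 344)] -/
theorem padicValNat_localTamagawaNumber_baseChange_eq_zero_of_not_split
    [Finite (IsLocalRing.ResidueField (𝔭.adicCompletionIntegers K))] (p : ℕ) [hp : Fact p.Prime]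
    (hodd : p ≠ 2)
    (hmult : V.HasMultiplicativeReductionAt v) (h𝔭 : 𝔭.asIdeal.under (𝓞 ℚ) = v.asIdeal)
    (hns : ¬ (V.baseChange K).HasSplitMultiplicativeReductionAt 𝔭) :
    padicValNat p (((V.baseChange K).baseChange (𝔭.adicCompletion K)).localTamagawaNumber
        (𝔭.adicCompletionIntegers K)) = 0 := by
  rcases localTamagawaNumber_baseChange_eq_one_or_two_of_not_split V 𝔭 hmult h𝔭 hns with h | h
  · rw [h, padicValNat_one_right]
  · rw [h]
    haveI : Fact (Nat.Prime 2) := ⟨Nat.prime_two⟩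
    exact padicValNat_primes hodd

/-- **Odd `p`: `v_p(c_𝔭(V ⊗ K)) = v_p(e(𝔭|v) · ord_v Δ_min(V))` at a SPLIT place above a
multiplicative place of `V`**. The split entry of the local identity (L_ℓ)@p of row T-MIL-ODD
(valid for every `p`; stated beside the non-split entry). [cite: SilvermanATAEC1994, IV.9.4 Step 2 and Cor. IV.9.2(d)] -/
theorem padicValNat_localTamagawaNumber_baseChange_of_split (p : ℕ)
    (hmult : V.HasMultiplicativeReductionAt v) (h𝔭 : 𝔭.asIdeal.under (𝓞 ℚ) = v.asIdeal)
    (hsplit : (V.baseChange K).HasSplitMultiplicativeReductionAt 𝔭) :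
    padicValNat p (((V.baseChange K).baseChange (𝔭.adicCompletion K)).localTamagawaNumber
        (𝔭.adicCompletionIntegers K)) =
      padicValNat p (v.asIdeal.ramificationIdx' 𝔭.asIdeal * V.ordMinimalDiscriminant v) := by
  rw [localTamagawaNumber_baseChange_eq_mul_ordMinimalDiscriminant_of_split V 𝔭 hmult h𝔭 hsplit]

end Tamagawa

/-! ## §4 The parity form at a place `𝔭 ∣ v` with `N(𝔭) = ℓ^f` (quadratic fields: `f ∈ {1, 2}`) -/

section Parity

variable (V : WeierstrassCurve ℚ) [V.IsElliptic] [V.IsGloballyMinimal]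
  {v : HeightOneSpectrum (𝓞 ℚ)} {K : Type} [Field K] [NumberField K]
  (𝔭 : HeightOneSpectrum (𝓞 K))

/-- **EVEN residue degree: `c_𝔭(V ⊗ K) = e(𝔭|v) · ord_v Δ_min(V)`** at a place above a
multiplicative (split OR non-split) place `v` of `V/ℚ` with `N(𝔭) = ℓ^f`, `f` even — e.g. the
place of a quadratic field above an INERT multiplicative prime (`e = 1`, `f = 2`: `c_𝔭 = n`
whether or not `V` is split at `ℓ`). [cite: SilvermanAEC2009, VII.5 Prop. 5.1(b) and Exercise 3.5]
[cite: SilvermanATAEC1994, IV.9.4 Step 2 and Cor. IV.9.2(d)] -/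
theorem localTamagawaNumber_baseChange_eq_mul_of_mult_of_even
    (hmult : V.HasMultiplicativeReductionAt v) (h𝔭 : 𝔭.asIdeal.under (𝓞 ℚ) = v.asIdeal)
    {f : ℕ} (hN : Ideal.absNorm 𝔭.asIdeal = (primesEquiv v : ℕ) ^ f) (hf : Even f) :
    ((V.baseChange K).baseChange (𝔭.adicCompletion K)).localTamagawaNumber
        (𝔭.adicCompletionIntegers K) =
      v.asIdeal.ramificationIdx' 𝔭.asIdeal * V.ordMinimalDiscriminant v := by
  haveI : Fact (primesEquiv v : ℕ).Prime := ⟨(primesEquiv v).2⟩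
  have hmultP : V.HasMultiplicativeReductionAtPrime (primesEquiv v : ℕ) :=
    (hasMultiplicativeReductionAtPrime_iff_hasMultiplicativeReductionAt_ringOfIntegers V v).mpr hmult
  exact localTamagawaNumber_baseChange_eq_mul_ordMinimalDiscriminant_of_split V 𝔭 hmult h𝔭
    (hasSplitMultiplicativeReductionAt_baseChange_of_mult_of_even V (primesEquiv v : ℕ) 𝔭
      (natCast_primesEquiv_mem_of_under_eq 𝔭 h𝔭) hmultP hN hf)

/-- **ODD residue degree, `V` NON-split at `v`: `c_𝔭(V ⊗ K) ∈ {1, 2}`** (`N(𝔭) = ℓ^f`, `f` odd —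
e.g. a split or a ramified prime of a quadratic field: non-split stays non-split).
[cite: SilvermanAEC2009, VII.5 Prop. 5.1(b) and Exercise 3.5] [cite: SilvermanATAEC1994, IV.9.4 Step 2 (PDF p. 344)] -/
theorem localTamagawaNumber_baseChange_eq_one_or_two_of_not_split_of_odd
    [Finite (IsLocalRing.ResidueField (𝔭.adicCompletionIntegers K))]
    (hmult : V.HasMultiplicativeReductionAt v) (hns : ¬ V.HasSplitMultiplicativeReductionAt v)
    (h𝔭 : 𝔭.asIdeal.under (𝓞 ℚ) = v.asIdeal)
    {f : ℕ} (hN : Ideal.absNorm 𝔭.asIdeal = (primesEquiv v : ℕ) ^ f) (hf : Odd f) :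
    ((V.baseChange K).baseChange (𝔭.adicCompletion K)).localTamagawaNumber
        (𝔭.adicCompletionIntegers K) = 1 ∨
      ((V.baseChange K).baseChange (𝔭.adicCompletion K)).localTamagawaNumber
        (𝔭.adicCompletionIntegers K) = 2 := by
  haveI : Fact (primesEquiv v : ℕ).Prime := ⟨(primesEquiv v).2⟩
  have hmultP : V.HasMultiplicativeReductionAtPrime (primesEquiv v : ℕ) :=
    (hasMultiplicativeReductionAtPrime_iff_hasMultiplicativeReductionAt_ringOfIntegers V v).mpr hmult
  refine localTamagawaNumber_baseChange_eq_one_or_two_of_not_split V 𝔭 hmult h𝔭 ?_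
  rw [hasSplitMultiplicativeReductionAt_baseChange_iff_of_mult_of_odd V (primesEquiv v : ℕ) 𝔭
    (natCast_primesEquiv_mem_of_under_eq 𝔭 h𝔭) hmultP hN hf,
    hasSplitMultiplicativeReductionAtPrime_iff_hasSplitMultiplicativeReductionAt V v]
  exact hns

end Parity

end Summit.BirchSwinnertonDyer.Rank1Residual.AdditivePotMult

end
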